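import Summits.Ventures.LatticeQCDFlow.Exactness.IMHCommonRandomNumbersMergedForever
import HarnessLib

/-!
# The parallel wall-clock of `R` coupled pairs of the exact sampler: the expected number of updates during which AT LEAST ONE of `R` pairs still
# differs is at most `t₀ + R·p₀·(1 − A)^{t₀}·W` for every `t₀` — hence `≤ t₀ + W` once `log(R p₀) ≤ t₀·A`: logarithmic in `R`

HONEST FRAMING: exact (Metropolis-corrected) sampling algorithms for lattice gauge theory;
figures of merit are autocorrelation/cost numbers at stated couplings and volumes; no
continuum-physics claim.

Venture `LatticeQCDFlow` (cell pub-lqcd), topic `Exactness`; FANOUT row 30 (lean-1, GEN-39).  NEW WORK of the cell; sequel to GEN-37/38's replica and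
meeting-time files.  Setting: `K = indepMH q w`, `w` normalised, maximal at `x₀`, `W = w(x₀)`, `r = 1 − 1/W`; CRN pair kernel `K̂`; `R` pair streams
`Z_0, …, Z_{R−1}` on a probability space `(Ω', μ)`, EACH distributed as the pair chain from ONE initial coupling `ν̂` (`p₀ = ν̂(Δᶜ)`) — NO independence is
needed.  The PARALLEL WALL-CLOCK is the number of update rounds during which at least one pair still differs,
`𝓦_R = #{n : ∃ j < R, X_n^{(j)} ≠ X′_n^{(j)}} = Σ_n 1{∃ j < R, Z_j(n) ∉ Δ}` (a `tsum` of indicators; when the `R` coupled estimators are run in lock-step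
in parallel, this is the number of rounds before all of them have merged, up to the burn-in offset):

* §1 (bookkeeping) **`measurableSet_someApart`**, **`measureReal_someApart_le`** — `P(∃ j < R, Z_j(n) ∉ Δ) ≤ min(1, R·rⁿ·p₀)` (union bound and
  GEN-37's one-time contraction).
* §2 **`integral_wallClock_eq_tsum`** — `E[𝓦_R] = Σ_n P(∃ j < R, Z_j(n) ∉ Δ)` (the series converges); **`integral_wallClock_le`** — for every `t₀`:
  `E[𝓦_R] ≤ t₀ + R·p₀·r^{t₀}·W`; **`integral_wallClock_le_of_log_le`** — `log(R p₀) ≤ t₀·A ⇒ E[𝓦_R] ≤ t₀ + W`: THE EXPECTED WALL-CLOCK OF `R`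
  PARALLEL COUPLED PAIRS IS AT MOST `W + ⌈W·log(R p₀)⌉` — LOGARITHMIC IN THE NUMBER OF REPLICAS, LINEAR IN THE COLD WEIGHT `W = 1/A`.
* §4 **`wallClock_tail_eq_of_indep`** — with MUTUALLY independent pairs `P(𝓦_R ≥ t) = 1 − (1 − P̂_{t−1}(Δᶜ))^R`: the law of the maximum of the `R`
  meeting times (from (cold, hot): `1 − (1 − r^{t−1})^R` by GEN-37's exactness).
* §3 THE LAW OF THE WALL-CLOCK: **`le_wallClock_iff_of_merged_stay`** [pathwise], **`wallClock_tail_eq`** — `P(𝓦_R ≥ t) = P(∃ j < R, Z_j(t − 1) ∉ Δ)` EXACTLY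
  for every `t ≥ 1` (with independence this is `1 − ∏_j P(Z_j(t − 1) ∈ Δ)` — the law of the maximal meeting time); **`wallClock_tail_le`** —
  `P(𝓦_R ≥ t) ≤ R·r^{t−1}·p₀`: geometric concentration above the logarithmic scale.
Reading (gauge files): `R` coupled pairs of two exact gauge samplers on one stream of random numbers each, run in parallel, have all merged after on
average at most `1/A + t₀` rounds as soon as `(1 − A)^{t₀} ≤ 1/(R p₀)`.
NOT CLAIMED: a lower bound on the mean; any value of `A`.  No `sorry`, no new definitions, nothing cited as a fact.
-/

noncomputable section

namespace Summit.Ventures.LatticeQCDFlow.Exactness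

open MeasureTheory ProbabilityTheory Function Finset Filter
open scoped ENNReal unitInterval Topology
open Summit.Ventures.LatticeQCDFlow.Scoring

variable {Ω : Type*} [MeasurableSpace Ω] {q : Measure Ω} [IsProbabilityMeasure q] {w : Ω → ℝ}

section Replicas

variable {Ω' : Type*} {mΩ' : MeasurableSpace Ω'} {μ : Measure Ω'} [IsProbabilityMeasure μ]
  {Z : ℕ → Ω' → (ℕ → Ω × Ω)}

/-! ## §1 One round: the probability that some pair still differs -/

omit [IsProbabilityMeasure μ] in
/-- The event «some pair among the first `R` still differs at round `n`» is measurable. [ours, bookkeeping] -/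
theorem measurableSet_someApart [MeasurableEq Ω] (hZm : ∀ j, Measurable (Z j)) (R n : ℕ) :
    MeasurableSet (⋃ j ∈ Finset.range R, {ω : Ω' | Z j ω n ∉ Set.diagonal Ω}) :=
  MeasurableSet.biUnion (Finset.range R).countable_toSet fun j _ =>
    ((measurableSet_diagonal.compl.preimage (measurable_pi_apply n)).preimage (hZm j) :
      MeasurableSet (Z j ⁻¹' ((fun z : ℕ → Ω × Ω => z n) ⁻¹' (Set.diagonal Ω)ᶜ)))

omit [IsProbabilityMeasure μ] in
/-- **`P(∃ j < R, Z_j(n) ∉ Δ) ≤ R·rⁿ·p₀`** (union bound; each stream has the law of the pair chain from `ν̂`). [ours] -/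
theorem measureReal_someApart_le [MeasurableEq Ω] (hw : Measurable w) (hw0 : ∀ y, 0 < w y) {x₀ : Ω} (hmax : ∀ y, w y ≤ w x₀)
    [IsProbabilityMeasure (q.withDensity fun y => ENNReal.ofReal (w y))]
    (Khat : Kernel (Ω × Ω) (Ω × Ω)) [IsMarkovKernel Khat]
    (hK : ∀ z : Ω × Ω, Khat z = (q.prod (volume : Measure unitInterval)).map (fun p : Ω × unitInterval =>
      ((if (p.2 : ℝ) * w z.1 ≤ w p.1 then p.1 else z.1), (if (p.2 : ℝ) * w z.2 ≤ w p.1 then p.1 else z.2))))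
    (ν : Measure (Ω × Ω)) [IsProbabilityMeasure ν] (hZm : ∀ j, Measurable (Z j))
    (hlaw : ∀ j, μ.map (Z j) = Kernel.trajMeasure (X := fun _ : ℕ => Ω × Ω) ν
      (fun n : ℕ => Khat.comap (fun h : (i : ↥(Finset.Iic n)) → Ω × Ω => h ⟨n, Finset.mem_Iic.2 le_rfl⟩)
        (measurable_pi_apply _))) (R n : ℕ) :
    μ.real (⋃ j ∈ Finset.range R, {ω : Ω' | Z j ω n ∉ Set.diagonal Ω}) ≤ R * ((1 - (w x₀)⁻¹) ^ n * ν.real (Set.diagonal Ω)ᶜ) := by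
  have hE : MeasurableSet {z : ℕ → Ω × Ω | z n ∉ Set.diagonal Ω} := measurableSet_diagonal.compl.preimage (measurable_pi_apply n)
  have hj : ∀ j, μ.real {ω : Ω' | Z j ω n ∉ Set.diagonal Ω} ≤ (1 - (w x₀)⁻¹) ^ n * ν.real (Set.diagonal Ω)ᶜ := by
    intro j
    have heq : μ.real {ω : Ω' | Z j ω n ∉ Set.diagonal Ω} = (μ.map (Z j)).real {z : ℕ → Ω × Ω | z n ∉ Set.diagonal Ω} := by
      rw [measureReal_def, measureReal_def, Measure.map_apply (hZm j) hE]; rfl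
    rw [heq, hlaw j, crn_chain_offDiagonal_real_eq Khat ν n]
    exact iterate_bind_crnPair_offDiagonal_le hw hw0 hmax Khat hK n ν
  calc μ.real (⋃ j ∈ Finset.range R, {ω : Ω' | Z j ω n ∉ Set.diagonal Ω})
      ≤ ∑ j ∈ Finset.range R, μ.real {ω : Ω' | Z j ω n ∉ Set.diagonal Ω} := measureReal_biUnion_finset_le _ _
    _ ≤ ∑ j ∈ Finset.range R, (1 - (w x₀)⁻¹) ^ n * ν.real (Set.diagonal Ω)ᶜ := sum_le_sum fun j _ => hj j
    _ = R * ((1 - (w x₀)⁻¹) ^ n * ν.real (Set.diagonal Ω)ᶜ) := by rw [sum_const, card_range, nsmul_eq_mul]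

/-! ## §2 The expected parallel wall-clock -/

/-- **`E[𝓦_R] = Σ_n P(∃ j < R, Z_j(n) ∉ Δ)`**, the series converging (terms `≤ R rⁿ p₀`). [ours] -/
theorem integral_wallClock_eq_tsum [MeasurableEq Ω] (hw : Measurable w) (hw0 : ∀ y, 0 < w y) {x₀ : Ω} (hmax : ∀ y, w y ≤ w x₀)
    [IsProbabilityMeasure (q.withDensity fun y => ENNReal.ofReal (w y))]
    (Khat : Kernel (Ω × Ω) (Ω × Ω)) [IsMarkovKernel Khat]
    (hK : ∀ z : Ω × Ω, Khat z = (q.prod (volume : Measure unitInterval)).map (fun p : Ω × unitInterval =>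
      ((if (p.2 : ℝ) * w z.1 ≤ w p.1 then p.1 else z.1), (if (p.2 : ℝ) * w z.2 ≤ w p.1 then p.1 else z.2))))
    (ν : Measure (Ω × Ω)) [IsProbabilityMeasure ν] (hZm : ∀ j, Measurable (Z j))
    (hlaw : ∀ j, μ.map (Z j) = Kernel.trajMeasure (X := fun _ : ℕ => Ω × Ω) ν
      (fun n : ℕ => Khat.comap (fun h : (i : ↥(Finset.Iic n)) → Ω × Ω => h ⟨n, Finset.mem_Iic.2 le_rfl⟩)
        (measurable_pi_apply _))) (R : ℕ) :
    Summable (fun n => μ.real (⋃ j ∈ Finset.range R, {ω : Ω' | Z j ω n ∉ Set.diagonal Ω})) ∧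
    ∫ ω, (∑' n, (⋃ j ∈ Finset.range R, {ω : Ω' | Z j ω n ∉ Set.diagonal Ω}).indicator (1 : Ω' → ℝ) ω) ∂μ =
      ∑' n, μ.real (⋃ j ∈ Finset.range R, {ω : Ω' | Z j ω n ∉ Set.diagonal Ω}) := by
  have hW : 1 ≤ w x₀ := one_le_of_mode (q := q) hmax
  have hWpos : 0 < w x₀ := hw0 x₀
  have hr0 : 0 ≤ 1 - (w x₀)⁻¹ := sub_nonneg.2 (inv_le_one_of_one_le₀ hW)
  have hr1 : 1 - (w x₀)⁻¹ < 1 := sub_lt_self _ (inv_pos.2 hWpos)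
  have hS : ∀ n, MeasurableSet (⋃ j ∈ Finset.range R, {ω : Ω' | Z j ω n ∉ Set.diagonal Ω}) := fun n => measurableSet_someApart hZm R n
  have hIi : ∀ n, Integrable ((⋃ j ∈ Finset.range R, {ω : Ω' | Z j ω n ∉ Set.diagonal Ω}).indicator (1 : Ω' → ℝ)) μ := fun n =>
    (integrable_const (1 : ℝ)).indicator (hS n)
  have hterm : ∀ n, ∫ ω, (⋃ j ∈ Finset.range R, {ω : Ω' | Z j ω n ∉ Set.diagonal Ω}).indicator (1 : Ω' → ℝ) ω ∂μ =
      μ.real (⋃ j ∈ Finset.range R, {ω : Ω' | Z j ω n ∉ Set.diagonal Ω}) := fun n => integral_indicator_one (hS n)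
  have hnorm : ∀ n, ∫ ω, ‖(⋃ j ∈ Finset.range R, {ω : Ω' | Z j ω n ∉ Set.diagonal Ω}).indicator (1 : Ω' → ℝ) ω‖ ∂μ =
      μ.real (⋃ j ∈ Finset.range R, {ω : Ω' | Z j ω n ∉ Set.diagonal Ω}) := by
    intro n
    rw [← hterm n]
    refine integral_congr_ae (ae_of_all _ fun ω => ?_)
    dsimp only
    rw [Real.norm_eq_abs]
    exact abs_of_nonneg (Set.indicator_nonneg (fun _ _ => zero_le_one) _)
  have hsum : Summable (fun n => μ.real (⋃ j ∈ Finset.range R, {ω : Ω' | Z j ω n ∉ Set.diagonal Ω})) := by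
    refine Summable.of_nonneg_of_le (fun n => measureReal_nonneg)
      (fun n => measureReal_someApart_le hw hw0 hmax Khat hK ν hZm hlaw R n) ?_
    have h := ((summable_geometric_of_lt_one hr0 hr1).mul_right (ν.real (Set.diagonal Ω)ᶜ)).mul_left (R : ℝ)
    exact h
  refine ⟨hsum, ?_⟩
  have hsum' : Summable (fun n => ∫ ω, ‖(⋃ j ∈ Finset.range R, {ω : Ω' | Z j ω n ∉ Set.diagonal Ω}).indicator (1 : Ω' → ℝ) ω‖ ∂μ) := by
    simp_rw [hnorm]; exact hsum
  rw [← integral_tsum_of_summable_integral_norm hIi hsum']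
  exact tsum_congr hterm

/-- **THE EXPECTED PARALLEL WALL-CLOCK: `E[𝓦_R] ≤ t₀ + R·p₀·r^{t₀}·W`** for every `t₀ ∈ ℕ` (the first `t₀` rounds cost at most `t₀`; afterwards the union
bound is summed geometrically). [ours] -/
theorem integral_wallClock_le [MeasurableEq Ω] (hw : Measurable w) (hw0 : ∀ y, 0 < w y) {x₀ : Ω} (hmax : ∀ y, w y ≤ w x₀)
    [IsProbabilityMeasure (q.withDensity fun y => ENNReal.ofReal (w y))]
    (Khat : Kernel (Ω × Ω) (Ω × Ω)) [IsMarkovKernel Khat]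
    (hK : ∀ z : Ω × Ω, Khat z = (q.prod (volume : Measure unitInterval)).map (fun p : Ω × unitInterval =>
      ((if (p.2 : ℝ) * w z.1 ≤ w p.1 then p.1 else z.1), (if (p.2 : ℝ) * w z.2 ≤ w p.1 then p.1 else z.2))))
    (ν : Measure (Ω × Ω)) [IsProbabilityMeasure ν] (hZm : ∀ j, Measurable (Z j))
    (hlaw : ∀ j, μ.map (Z j) = Kernel.trajMeasure (X := fun _ : ℕ => Ω × Ω) ν
      (fun n : ℕ => Khat.comap (fun h : (i : ↥(Finset.Iic n)) → Ω × Ω => h ⟨n, Finset.mem_Iic.2 le_rfl⟩)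
        (measurable_pi_apply _))) (R t₀ : ℕ) :
    ∫ ω, (∑' n, (⋃ j ∈ Finset.range R, {ω : Ω' | Z j ω n ∉ Set.diagonal Ω}).indicator (1 : Ω' → ℝ) ω) ∂μ ≤
      t₀ + R * ν.real (Set.diagonal Ω)ᶜ * (1 - (w x₀)⁻¹) ^ t₀ * w x₀ := by
  have hW : 1 ≤ w x₀ := one_le_of_mode (q := q) hmax
  have hWpos : 0 < w x₀ := hw0 x₀
  have hr0 : 0 ≤ 1 - (w x₀)⁻¹ := sub_nonneg.2 (inv_le_one_of_one_le₀ hW)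
  have hr1 : 1 - (w x₀)⁻¹ < 1 := sub_lt_self _ (inv_pos.2 hWpos)
  obtain ⟨hsum, heq⟩ := integral_wallClock_eq_tsum hw hw0 hmax Khat hK ν hZm hlaw R
  rw [heq, ← Summable.sum_add_tsum_nat_add t₀ hsum]
  -- the first `t₀` rounds: each probability is at most one
  have h1 : ∑ n ∈ Finset.range t₀, μ.real (⋃ j ∈ Finset.range R, {ω : Ω' | Z j ω n ∉ Set.diagonal Ω}) ≤ t₀ :=
    calc ∑ n ∈ Finset.range t₀, μ.real (⋃ j ∈ Finset.range R, {ω : Ω' | Z j ω n ∉ Set.diagonal Ω})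
        ≤ ∑ n ∈ Finset.range t₀, (1 : ℝ) := sum_le_sum fun n _ => measureReal_le_one
      _ = t₀ := by rw [sum_const, card_range, nsmul_eq_mul, mul_one]
  -- the tail: the union bound summed geometrically
  have hgeo : HasSum (fun n : ℕ => R * ((1 - (w x₀)⁻¹) ^ (n + t₀) * ν.real (Set.diagonal Ω)ᶜ))
      (R * ν.real (Set.diagonal Ω)ᶜ * (1 - (w x₀)⁻¹) ^ t₀ * w x₀) := by
    have h := ((hasSum_geometric_of_lt_one hr0 hr1).mul_left (R * ν.real (Set.diagonal Ω)ᶜ * (1 - (w x₀)⁻¹) ^ t₀))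
    have hlim : R * ν.real (Set.diagonal Ω)ᶜ * (1 - (w x₀)⁻¹) ^ t₀ * (1 - (1 - (w x₀)⁻¹))⁻¹ =
        R * ν.real (Set.diagonal Ω)ᶜ * (1 - (w x₀)⁻¹) ^ t₀ * w x₀ := by rw [sub_sub_cancel, inv_inv]
    rw [hlim] at h
    refine h.congr_fun fun n => ?_
    rw [pow_add]; ring
  have h2 : ∑' n, μ.real (⋃ j ∈ Finset.range R, {ω : Ω' | Z j ω (n + t₀) ∉ Set.diagonal Ω}) ≤
      R * ν.real (Set.diagonal Ω)ᶜ * (1 - (w x₀)⁻¹) ^ t₀ * w x₀ := by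
    rw [← hgeo.tsum_eq]
    exact ((summable_nat_add_iff t₀).2 hsum).tsum_le_tsum (fun n => measureReal_someApart_le hw hw0 hmax Khat hK ν hZm hlaw R (n + t₀)) hgeo.summable
  linarith

/-- **THE LOG RULE: `log(R·p₀) ≤ t₀·A ⇒ E[𝓦_R] ≤ t₀ + W`** — the expected parallel wall-clock of `R` coupled pairs is at most the cold weight plus a
number of rounds logarithmic in `R` (`p₀ = ν̂(Δᶜ) > 0`). [ours] -/
theorem integral_wallClock_le_of_log_le [MeasurableEq Ω] (hw : Measurable w) (hw0 : ∀ y, 0 < w y) {x₀ : Ω} (hmax : ∀ y, w y ≤ w x₀)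
    [IsProbabilityMeasure (q.withDensity fun y => ENNReal.ofReal (w y))]
    (Khat : Kernel (Ω × Ω) (Ω × Ω)) [IsMarkovKernel Khat]
    (hK : ∀ z : Ω × Ω, Khat z = (q.prod (volume : Measure unitInterval)).map (fun p : Ω × unitInterval =>
      ((if (p.2 : ℝ) * w z.1 ≤ w p.1 then p.1 else z.1), (if (p.2 : ℝ) * w z.2 ≤ w p.1 then p.1 else z.2))))
    (ν : Measure (Ω × Ω)) [IsProbabilityMeasure ν] (hZm : ∀ j, Measurable (Z j))
    (hlaw : ∀ j, μ.map (Z j) = Kernel.trajMeasure (X := fun _ : ℕ => Ω × Ω) ν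
      (fun n : ℕ => Khat.comap (fun h : (i : ↥(Finset.Iic n)) → Ω × Ω => h ⟨n, Finset.mem_Iic.2 le_rfl⟩)
        (measurable_pi_apply _))) {R : ℕ} (hp : 0 < R * ν.real (Set.diagonal Ω)ᶜ) {t₀ : ℕ}
    (ht : Real.log (R * ν.real (Set.diagonal Ω)ᶜ) ≤ t₀ * (w x₀)⁻¹) :
    ∫ ω, (∑' n, (⋃ j ∈ Finset.range R, {ω : Ω' | Z j ω n ∉ Set.diagonal Ω}).indicator (1 : Ω' → ℝ) ω) ∂μ ≤ t₀ + w x₀ := by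
  have h := integral_wallClock_le hw hw0 hmax Khat hK ν hZm hlaw R t₀
  have hW : 1 ≤ w x₀ := one_le_of_mode (q := q) hmax
  have hWpos : 0 < w x₀ := hw0 x₀
  have hr0 : 0 ≤ 1 - (w x₀)⁻¹ := sub_nonneg.2 (inv_le_one_of_one_le₀ hW)
  -- `r^{t₀} ≤ exp(−t₀·A) ≤ 1/(R p₀)`
  have hrn : (1 - (w x₀)⁻¹) ^ t₀ ≤ (R * ν.real (Set.diagonal Ω)ᶜ)⁻¹ := by
    calc (1 - (w x₀)⁻¹) ^ t₀ ≤ Real.exp (-(w x₀)⁻¹) ^ t₀ := by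
          gcongr
          have := Real.add_one_le_exp (-(w x₀)⁻¹)
          linarith
      _ = Real.exp (-(t₀ * (w x₀)⁻¹)) := by rw [← Real.exp_nat_mul]; ring_nf
      _ ≤ Real.exp (-Real.log (R * ν.real (Set.diagonal Ω)ᶜ)) := Real.exp_le_exp.2 (neg_le_neg ht)
      _ = (R * ν.real (Set.diagonal Ω)ᶜ)⁻¹ := by rw [Real.exp_neg, Real.exp_log hp]
  have hprod : R * ν.real (Set.diagonal Ω)ᶜ * (1 - (w x₀)⁻¹) ^ t₀ * w x₀ ≤ w x₀ := by
    have h1 : R * ν.real (Set.diagonal Ω)ᶜ * (1 - (w x₀)⁻¹) ^ t₀ ≤ 1 := by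
      calc R * ν.real (Set.diagonal Ω)ᶜ * (1 - (w x₀)⁻¹) ^ t₀ ≤ R * ν.real (Set.diagonal Ω)ᶜ * (R * ν.real (Set.diagonal Ω)ᶜ)⁻¹ :=
            mul_le_mul_of_nonneg_left hrn hp.le
        _ = 1 := mul_inv_cancel₀ hp.ne'
    calc R * ν.real (Set.diagonal Ω)ᶜ * (1 - (w x₀)⁻¹) ^ t₀ * w x₀ ≤ 1 * w x₀ := mul_le_mul_of_nonneg_right h1 hWpos.le
      _ = w x₀ := one_mul _
  linarith

/-! ## §3 The law of the parallel wall-clock: its tail is a one-round probability -/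

omit [MeasurableSpace Ω] [IsProbabilityMeasure μ] in
/-- Pathwise: if each of the `R` pair paths stays merged once merged, the union indicators `1{∃ j < R, Z_j(n) ∉ Δ}` are non-increasing in `n`, so for
`t ≥ 1` (and a summable indicator sequence) `t ≤ 𝓦_R(ω) ↔ ∃ j < R, Z_j(t − 1) ∉ Δ`. [ours, bookkeeping] -/
theorem le_wallClock_iff_of_merged_stay {ω : Ω'} {R : ℕ}
    (hz : ∀ j ∈ Finset.range R, ∀ n m, n ≤ m → Z j ω n ∈ Set.diagonal Ω → Z j ω m ∈ Set.diagonal Ω)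
    (hsum : Summable fun n => (⋃ j ∈ Finset.range R, {ω : Ω' | Z j ω n ∉ Set.diagonal Ω}).indicator (1 : Ω' → ℝ) ω) {t : ℕ} (ht : 1 ≤ t) :
    (t : ℝ) ≤ ∑' n, (⋃ j ∈ Finset.range R, {ω : Ω' | Z j ω n ∉ Set.diagonal Ω}).indicator (1 : Ω' → ℝ) ω ↔
      ω ∈ ⋃ j ∈ Finset.range R, {ω : Ω' | Z j ω (t - 1) ∉ Set.diagonal Ω} := by
  -- antitone: apart at a later round implies apart at an earlier round
  have hanti : ∀ n m, n ≤ m → ω ∈ (⋃ j ∈ Finset.range R, {ω : Ω' | Z j ω m ∉ Set.diagonal Ω}) →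
      ω ∈ ⋃ j ∈ Finset.range R, {ω : Ω' | Z j ω n ∉ Set.diagonal Ω} := by
    intro n m hnm hm
    simp only [Set.mem_iUnion, Set.mem_setOf_eq, exists_prop] at hm ⊢
    obtain ⟨j, hj, hjm⟩ := hm
    exact ⟨j, hj, fun hjn => hjm (hz j hj n m hnm hjn)⟩
  constructor
  · intro hT
    by_contra hmem
    -- every indicator with index `≥ t − 1` vanishes: the `tsum` is a sum over `range (t − 1)`, at most `t − 1`
    have hzero : ∀ n, n ∉ Finset.range (t - 1) →
        (⋃ j ∈ Finset.range R, {ω : Ω' | Z j ω n ∉ Set.diagonal Ω}).indicator (1 : Ω' → ℝ) ω = 0 := by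
      intro n hn
      have hle : t - 1 ≤ n := Nat.le_of_not_lt fun h => hn (Finset.mem_range.2 h)
      exact Set.indicator_of_notMem (fun h => hmem (hanti (t - 1) n hle h)) _
    have hts : ∑' n, (⋃ j ∈ Finset.range R, {ω : Ω' | Z j ω n ∉ Set.diagonal Ω}).indicator (1 : Ω' → ℝ) ω =
        ∑ n ∈ Finset.range (t - 1), (⋃ j ∈ Finset.range R, {ω : Ω' | Z j ω n ∉ Set.diagonal Ω}).indicator (1 : Ω' → ℝ) ω := tsum_eq_sum hzero
    have hle : ∑ n ∈ Finset.range (t - 1), (⋃ j ∈ Finset.range R, {ω : Ω' | Z j ω n ∉ Set.diagonal Ω}).indicator (1 : Ω' → ℝ) ω ≤ (t - 1 : ℕ) :=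
      calc ∑ n ∈ Finset.range (t - 1), (⋃ j ∈ Finset.range R, {ω : Ω' | Z j ω n ∉ Set.diagonal Ω}).indicator (1 : Ω' → ℝ) ω
          ≤ ∑ n ∈ Finset.range (t - 1), (1 : ℝ) := sum_le_sum fun n _ => Set.indicator_le_self' (fun _ _ => zero_le_one) _
        _ = (t - 1 : ℕ) := by rw [sum_const, card_range, nsmul_eq_mul, mul_one]
    have hcast : ((t - 1 : ℕ) : ℝ) = (t : ℝ) - 1 := by rw [Nat.cast_sub ht, Nat.cast_one]
    rw [hts] at hT
    linarith
  · intro hmem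
    have hall : ∀ n, n < t → ω ∈ ⋃ j ∈ Finset.range R, {ω : Ω' | Z j ω n ∉ Set.diagonal Ω} := fun n hn =>
      hanti n (t - 1) (Nat.le_sub_one_of_lt hn) hmem
    have hsumt : ∑ n ∈ Finset.range t, (⋃ j ∈ Finset.range R, {ω : Ω' | Z j ω n ∉ Set.diagonal Ω}).indicator (1 : Ω' → ℝ) ω = t := by
      rw [Finset.sum_congr rfl fun n hn => (by
        rw [Set.indicator_of_mem (hall n (Finset.mem_range.1 hn)), Pi.one_apply] :
          (⋃ j ∈ Finset.range R, {ω : Ω' | Z j ω n ∉ Set.diagonal Ω}).indicator (1 : Ω' → ℝ) ω = 1), sum_const, card_range, nsmul_eq_mul, mul_one]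
    rw [← hsumt]
    exact hsum.sum_le_tsum (Finset.range t) fun n _ => Set.indicator_nonneg (fun _ _ => zero_le_one) _

omit [IsProbabilityMeasure μ] in
/-- **THE TAIL OF THE PARALLEL WALL-CLOCK IS A ONE-ROUND PROBABILITY: `P(𝓦_R ≥ t) = P(∃ j < R, Z_j(t − 1) ∉ Δ)`** for every `t ≥ 1` (each stream
distributed as the pair chain; merged pairs stay merged almost surely). [ours] -/
theorem wallClock_tail_eq [MeasurableEq Ω] (hw : Measurable w) (hw0 : ∀ y, 0 < w y) {x₀ : Ω} (hmax : ∀ y, w y ≤ w x₀)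
    [IsProbabilityMeasure (q.withDensity fun y => ENNReal.ofReal (w y))]
    (Khat : Kernel (Ω × Ω) (Ω × Ω)) [IsMarkovKernel Khat]
    (hK : ∀ z : Ω × Ω, Khat z = (q.prod (volume : Measure unitInterval)).map (fun p : Ω × unitInterval =>
      ((if (p.2 : ℝ) * w z.1 ≤ w p.1 then p.1 else z.1), (if (p.2 : ℝ) * w z.2 ≤ w p.1 then p.1 else z.2))))
    (ν : Measure (Ω × Ω)) [IsProbabilityMeasure ν] (hZm : ∀ j, Measurable (Z j))
    (hlaw : ∀ j, μ.map (Z j) = Kernel.trajMeasure (X := fun _ : ℕ => Ω × Ω) ν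
      (fun n : ℕ => Khat.comap (fun h : (i : ↥(Finset.Iic n)) → Ω × Ω => h ⟨n, Finset.mem_Iic.2 le_rfl⟩)
        (measurable_pi_apply _))) (R : ℕ) {t : ℕ} (ht : 1 ≤ t) :
    μ.real {ω | (t : ℝ) ≤ ∑' n, (⋃ j ∈ Finset.range R, {ω : Ω' | Z j ω n ∉ Set.diagonal Ω}).indicator (1 : Ω' → ℝ) ω} =
      μ.real (⋃ j ∈ Finset.range R, {ω : Ω' | Z j ω (t - 1) ∉ Set.diagonal Ω}) := by
  -- a.s. every stream stays merged once merged and merges eventually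
  have hstay : ∀ᵐ ω ∂μ, ∀ j, ∀ n m, n ≤ m → Z j ω n ∈ Set.diagonal Ω → Z j ω m ∈ Set.diagonal Ω := by
    rw [ae_all_iff]; intro j
    exact ae_of_ae_map (hZm j).aemeasurable (by rw [hlaw j]; exact crn_chain_ae_merged_stay hw hw0 Khat hK ν)
  have hmerge : ∀ᵐ ω ∂μ, ∀ j, ∃ n, ∀ m, n ≤ m → (Z j ω m).1 = (Z j ω m).2 := by
    rw [ae_all_iff]; intro j
    exact ae_of_ae_map (hZm j).aemeasurable (by rw [hlaw j]; exact crn_chain_ae_eventually_merged hw hw0 hmax Khat hK ν)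
  have hae : {ω | (t : ℝ) ≤ ∑' n, (⋃ j ∈ Finset.range R, {ω : Ω' | Z j ω n ∉ Set.diagonal Ω}).indicator (1 : Ω' → ℝ) ω} =ᵐ[μ]
      (⋃ j ∈ Finset.range R, {ω : Ω' | Z j ω (t - 1) ∉ Set.diagonal Ω}) := by
    filter_upwards [hstay, hmerge] with ω hs hm
    -- summability: beyond the largest of the `R` merging times every union indicator vanishes
    classical
    have hsum : Summable fun n => (⋃ j ∈ Finset.range R, {ω : Ω' | Z j ω n ∉ Set.diagonal Ω}).indicator (1 : Ω' → ℝ) ω := by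
      let n₀ : ℕ → ℕ := fun j => Classical.choose (hm j)
      have hn₀ : ∀ j m, n₀ j ≤ m → (Z j ω m).1 = (Z j ω m).2 := fun j => Classical.choose_spec (hm j)
      refine summable_of_ne_finset_zero (s := Finset.range (∑ j ∈ Finset.range R, n₀ j)) fun n hn => ?_
      have hle : ∑ j ∈ Finset.range R, n₀ j ≤ n := Nat.le_of_not_lt fun h => hn (Finset.mem_range.2 h)
      refine Set.indicator_of_notMem (fun h => ?_) _
      simp only [Set.mem_iUnion, Set.mem_setOf_eq, exists_prop] at h
      obtain ⟨j, hj, hjn⟩ := h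
      exact hjn (Set.mem_diagonal_iff.2 (hn₀ j n ((Finset.single_le_sum (fun i _ => Nat.zero_le (n₀ i)) hj).trans hle)))
    exact propext (le_wallClock_iff_of_merged_stay (fun j _ => hs j) hsum ht)
  exact measureReal_congr hae

omit [IsProbabilityMeasure μ] in
/-- **`P(𝓦_R ≥ t) ≤ R·r^{t−1}·p₀`** for every `t ≥ 1`: the parallel wall-clock exceeds `t₀ + s` rounds with probability at most `R p₀ r^{t₀+s−1}` —
geometric concentration above the logarithmic mean scale. [ours] -/
theorem wallClock_tail_le [MeasurableEq Ω] (hw : Measurable w) (hw0 : ∀ y, 0 < w y) {x₀ : Ω} (hmax : ∀ y, w y ≤ w x₀)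
    [IsProbabilityMeasure (q.withDensity fun y => ENNReal.ofReal (w y))]
    (Khat : Kernel (Ω × Ω) (Ω × Ω)) [IsMarkovKernel Khat]
    (hK : ∀ z : Ω × Ω, Khat z = (q.prod (volume : Measure unitInterval)).map (fun p : Ω × unitInterval =>
      ((if (p.2 : ℝ) * w z.1 ≤ w p.1 then p.1 else z.1), (if (p.2 : ℝ) * w z.2 ≤ w p.1 then p.1 else z.2))))
    (ν : Measure (Ω × Ω)) [IsProbabilityMeasure ν] (hZm : ∀ j, Measurable (Z j))
    (hlaw : ∀ j, μ.map (Z j) = Kernel.trajMeasure (X := fun _ : ℕ => Ω × Ω) ν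
      (fun n : ℕ => Khat.comap (fun h : (i : ↥(Finset.Iic n)) → Ω × Ω => h ⟨n, Finset.mem_Iic.2 le_rfl⟩)
        (measurable_pi_apply _))) (R : ℕ) {t : ℕ} (ht : 1 ≤ t) :
    μ.real {ω | (t : ℝ) ≤ ∑' n, (⋃ j ∈ Finset.range R, {ω : Ω' | Z j ω n ∉ Set.diagonal Ω}).indicator (1 : Ω' → ℝ) ω} ≤
      R * ((1 - (w x₀)⁻¹) ^ (t - 1) * ν.real (Set.diagonal Ω)ᶜ) := by
  rw [wallClock_tail_eq hw hw0 hmax Khat hK ν hZm hlaw R ht]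
  exact measureReal_someApart_le hw hw0 hmax Khat hK ν hZm hlaw R (t - 1)

/-! ## §4 Independent pairs: the product formula -/

/-- **WITH MUTUALLY INDEPENDENT PAIRS THE WALL-CLOCK'S TAIL IS A PRODUCT**: `P(𝓦_R ≥ t) = 1 − ∏_{j<R} (1 − P(X_{t−1} ≠ X′_{t−1})) = 1 − (1 − P̂_{t−1}(Δᶜ))^R`
— the law of the maximum of the `R` meeting times (each stream distributed as the pair chain from `ν̂`). [ours] -/
theorem wallClock_tail_eq_of_indep [MeasurableEq Ω] (hw : Measurable w) (hw0 : ∀ y, 0 < w y) {x₀ : Ω} (hmax : ∀ y, w y ≤ w x₀)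
    [IsProbabilityMeasure (q.withDensity fun y => ENNReal.ofReal (w y))]
    (Khat : Kernel (Ω × Ω) (Ω × Ω)) [IsMarkovKernel Khat]
    (hK : ∀ z : Ω × Ω, Khat z = (q.prod (volume : Measure unitInterval)).map (fun p : Ω × unitInterval =>
      ((if (p.2 : ℝ) * w z.1 ≤ w p.1 then p.1 else z.1), (if (p.2 : ℝ) * w z.2 ≤ w p.1 then p.1 else z.2))))
    (ν : Measure (Ω × Ω)) [IsProbabilityMeasure ν] (hZm : ∀ j, Measurable (Z j))
    (hlaw : ∀ j, μ.map (Z j) = Kernel.trajMeasure (X := fun _ : ℕ => Ω × Ω) ν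
      (fun n : ℕ => Khat.comap (fun h : (i : ↥(Finset.Iic n)) → Ω × Ω => h ⟨n, Finset.mem_Iic.2 le_rfl⟩)
        (measurable_pi_apply _))) (hind : iIndepFun Z μ) (R : ℕ) {t : ℕ} (ht : 1 ≤ t) :
    μ.real {ω | (t : ℝ) ≤ ∑' n, (⋃ j ∈ Finset.range R, {ω : Ω' | Z j ω n ∉ Set.diagonal Ω}).indicator (1 : Ω' → ℝ) ω} =
      1 - (1 - ((fun m : Measure (Ω × Ω) => m.bind Khat)^[t - 1] ν).real (Set.diagonal Ω)ᶜ) ^ R := by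
  rw [wallClock_tail_eq hw hw0 hmax Khat hK ν hZm hlaw R ht]
  have hE : MeasurableSet {z : ℕ → Ω × Ω | z (t - 1) ∈ Set.diagonal Ω} := measurableSet_diagonal.preimage (measurable_pi_apply (t - 1))
  -- complement: all `R` pairs merged at round `t − 1`, an intersection of independent events
  have hcompl : (⋃ j ∈ Finset.range R, {ω : Ω' | Z j ω (t - 1) ∉ Set.diagonal Ω})ᶜ =
      ⋂ j ∈ Finset.range R, Z j ⁻¹' {z | z (t - 1) ∈ Set.diagonal Ω} := by
    ext ω; simp
  have hmeas : MeasurableSet (⋃ j ∈ Finset.range R, {ω : Ω' | Z j ω (t - 1) ∉ Set.diagonal Ω}) := measurableSet_someApart hZm R (t - 1)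
  have hprod : μ (⋂ j ∈ Finset.range R, Z j ⁻¹' {z | z (t - 1) ∈ Set.diagonal Ω}) =
      ∏ j ∈ Finset.range R, μ (Z j ⁻¹' {z | z (t - 1) ∈ Set.diagonal Ω}) :=
    hind.meas_biInter fun j _ => ⟨_, hE, rfl⟩
  have hj : ∀ j, (μ (Z j ⁻¹' {z | z (t - 1) ∈ Set.diagonal Ω})).toReal = 1 - ((fun m : Measure (Ω × Ω) => m.bind Khat)^[t - 1] ν).real (Set.diagonal Ω)ᶜ := by
    intro j
    haveI : IsProbabilityMeasure (μ.map (Z j)) := Measure.isProbabilityMeasure_map (hZm j).aemeasurable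
    have h1 : (μ (Z j ⁻¹' {z | z (t - 1) ∈ Set.diagonal Ω})).toReal = (μ.map (Z j)).real {z | z (t - 1) ∈ Set.diagonal Ω} := by
      rw [measureReal_def, Measure.map_apply (hZm j) hE]
    have hc : {z : ℕ → Ω × Ω | z (t - 1) ∈ Set.diagonal Ω} = {z : ℕ → Ω × Ω | z (t - 1) ∉ Set.diagonal Ω}ᶜ := by
      ext z; simp
    have hEn : MeasurableSet {z : ℕ → Ω × Ω | z (t - 1) ∉ Set.diagonal Ω} := measurableSet_diagonal.compl.preimage (measurable_pi_apply (t - 1))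
    have h2 : (μ.map (Z j)).real {z | z (t - 1) ∈ Set.diagonal Ω} = 1 - (μ.map (Z j)).real {z | z (t - 1) ∉ Set.diagonal Ω} := by
      rw [hc, measureReal_compl hEn, probReal_univ]
    rw [h1, h2, hlaw j, crn_chain_offDiagonal_real_eq Khat ν (t - 1)]
  -- `P(⋃) = 1 − P(⋂ of complements)` and the product of the (equal) factors
  have hU : μ.real (⋃ j ∈ Finset.range R, {ω : Ω' | Z j ω (t - 1) ∉ Set.diagonal Ω}) =
      1 - μ.real (⋂ j ∈ Finset.range R, Z j ⁻¹' {z | z (t - 1) ∈ Set.diagonal Ω}) := by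
    have h := measureReal_compl (μ := μ) hmeas
    rw [probReal_univ, hcompl] at h
    linarith
  rw [hU, measureReal_def, hprod, ENNReal.toReal_prod, Finset.prod_congr rfl fun j _ => hj j, Finset.prod_const, Finset.card_range]

end Replicas

end Summit.Ventures.LatticeQCDFlow.Exactness

end
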